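import Mathlib
import HarnessLib
import Literature.Probability.MarkovChains.PseudoMarginalVarianceOrder

/-!
# Bounded weights: the pseudo-marginal asymptotic variance is at most `w̄` times the marginal one
# (Andrieu–Vihola 2015, Proposition 10 and Corollary 11)

HONEST FRAMING: exact (Metropolis-corrected) sampling algorithms for lattice gauge theory;
figures of merit are autocorrelation/cost numbers at stated couplings and volumes; no
continuum-physics claim.

Setting (finite form; the vocabulary of `PseudoMarginal.lean`, `PseudoMarginalAcceptance.lean`,
`PeskunOrdering.lean`, `PseudoMarginalVariance.lean`).  `X` finite with a positive probability
vector `π`, `T ≥ 0` a proposal matrix with row sums `≤ 1`, `f : X → Ξ → ℝ` a positive unbiased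
estimator of `π` with noise law `g` (`Σ g = 1`), `P = mhKernel T π` the marginal chain,
`P̃ = kernel T f g` the pseudo-marginal chain on `X × Ξ` for `π̃ = target f g`.  The companion file
`PseudoMarginalVariance.lean` proves `v(u, P) ≤ v(ũ, P̃)` ([cite: AndrieuVihola2015, Theorem 7]);
this file proves the CONVERSE BOUND under uniformly bounded normalised weights
`w = f x ξ / π x ≤ w̄`:

* `PseudoMarginal.barKernel` — the auxiliary kernel
  `P̄(x,w; dy × du) := q(x,dy) π_y(du) min{1, r(x,y)} + δ_{x,w}(dy × du) ρ(x)` on `X × Ξ` (move the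
  state by the MARGINAL chain, refresh the noise from the tilted law `π_y(du) = Q_y(du) u`), written
  as the Metropolis–Hastings kernel on `X × Ξ` with proposal `T x y · g ξ' f y ξ' / π y` and weight
  `π̃` — "reversible with respect to `π̃`" [cite: AndrieuVihola2015, §2 eq. (P̄) (the display
  defining `P̄`, after Lemma 1)]; `barKernel_mulVec_lift` — `P̄` acts on observables of the state as
  `P` ("`P̄ᵏ f̄(x,w) = Pᵏ f̄(x)`") and `asympVar_lift_barKernel` — `var(f, P̄) = var(f, P)` ("coincides
  marginally with the marginal chain") [cite: AndrieuVihola2015, §3 (proof of Theorem 7, first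
  paragraph)].
* `PseudoMarginal.dirichletForm_barKernel_le` — [cite: AndrieuVihola2015, §3 Proposition 10]:
  if `Q_x([0, w̄]) = 1` for all `x` then `𝓔_P̃(f) ≥ w̄⁻¹ 𝓔_P̄(f)` for EVERY function `f` of `(x, w)`
  ("Because `min{1, ab} ≥ min{1, a} min{1, b}` … `≥ 2w̄⁻¹ 𝓔_P̄(f)`"); here as `𝓔_P̄(φ) ≤ w̄ 𝓔_P̃(φ)`.
* `piInner_fundamentalMatrix_le_of_dirichletForm_le` — the finite form of the
  Caracciolo–Pelissetto–Sokal operator lemma used in the printed proof: `0 ≤ c⟨φ,(I − K₂)φ⟩ ≤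
  ⟨φ,(I − K₁)φ⟩` for all `φ` gives `⟨g, Z₁ g⟩ ≤ c⁻¹⟨g, Z₂ g⟩` on centred `g`
  [cite: AndrieuVihola2015, Appendix §10 Lemma 53 ("`0 ≤ ⟨f, Af⟩ ≤ ⟨f, Bf⟩` … Then
  `⟨f, B⁻¹f⟩ ≤ ⟨f, A⁻¹f⟩`", after Caracciolo–Pelissetto–Sokal)], proved by the tree's variational
  formula (`variational_eq` / `variational_le`) and scaling.
* **`PseudoMarginal.asympVar_lift_le_of_weight_le` — [cite: AndrieuVihola2015, §3 Corollary 11]**: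
  "Assume … there exists some `w̄ ∈ [1, ∞)` such that (weights a.s. bounded by `w̄`) holds.  Let
  `g : X → ℝ` … then the asymptotic variances satisfy
  `var(g, P) ≤ var(g, P̃) ≤ w̄ var(g, P) + (w̄ − 1) var_π(g)`" — the right-hand inequality (the
  left-hand one is `asympVar_le_asympVar_lift`); finite irreducible form, so the printed hypothesis
  `Gap(P) > 0` (finiteness of the variances) is automatic.

PROOF ROUTE (as printed, [cite: AndrieuVihola2015, §3 (proof of Corollary 11)]): Proposition 10
gives `⟨φ, (I − P̃)φ⟩_π̃ ≥ ⟨φ, w̄⁻¹(I − P̄)φ⟩_π̃` for all `φ`; the operator lemma gives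
`⟨g̃, (I − P̃)⁻¹ g̃⟩_π̃ ≤ w̄ ⟨g̃, (I − P̄)⁻¹ g̃⟩_π̃`; then "`var_π̃(g̃) = var_π(g)` and `var(g̃, P̄) = var(g, P)`
hold because `P̄` and `P` coincide marginally", and `var_π(g) + var(g, P) ≤ var_π̃(g̃) + var(g̃, P̃)
≤ w̄(var_π̃(g̃) + var(g̃, P̄))`.  Finite rendering: `(I − K)⁻¹` on `L²₀` is the fundamental matrix `Z`
(`2⟨ḡ, Z ḡ⟩ − ‖ḡ‖² = v`, `asympVar_eq_centred`), `var(g̃, P̄) = var(g, P)` is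
`fundamentalMatrix_barKernel_mulVec_lift` (`Z̄ ũ = lift (Z u)`); irreducibility is assumed for `P̃`
only and transferred to `P̄` and `P` (same pattern of possible moves).

Deliberately NOT here: the spectral-gap statements `Gap(P̃) ≥ w̄⁻¹ Gap(P̄)`,
`Gap(P) ∧ (1 − ess sup ρ) ≤ Gap(P̄) ≤ Gap(P)` [cite: AndrieuVihola2015, §3 Propositions 8 and 10]
and the necessity of bounded weights for a spectral gap (Proposition 13); general state spaces.
TODO(general form).

Context: cell pub-lqcd (venture LatticeQCDFlow), R2-SCOPE.md §3 E2 D2, §4 C-PM, §6 (5): the two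
files together say, value-free, that a stochastic determinant estimate with normalised weights in
`(0, w̄]` costs AT LEAST nothing and AT MOST a factor `w̄` in asymptotic variance plus `(w̄ − 1)` static
variances, for every gauge-field observable and every proposal.
-/

namespace Literature.Probability.MarkovChains

open Finset Matrix

variable {X : Type*} [Fintype X] [DecidableEq X]

/-! ## Two generic facts on finite chains -/

/-- **A Metropolis–Hastings kernel acts through its rates**:
`(P v)(x) = v x + Σ_y mhRate T π x y · (v y − v x)` (the rejected mass sits on the diagonal).
[cite: AndrieuVihola2015, §1 (the kernel `P(x, dy) = q(x,dy) min{1, r(x,y)} + δ_x(dy) ρ(x)`)] -/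
theorem mhKernel_mulVec_apply (T : X → X → ℝ) (π : X → ℝ) (v : X → ℝ) (x : X) :
    ((mhKernel T π : Matrix X X ℝ) *ᵥ v) x = v x + ∑ y, mhRate T π x y * (v y - v x) := by
  simp only [Matrix.mulVec, dotProduct]
  rw [← add_sum_erase _ _ (mem_univ x), mhKernel_self]
  have h1 : ∑ y ∈ univ.erase x, mhKernel T π x y * v y = ∑ y ∈ univ.erase x, mhRate T π x y * v y :=
    sum_congr rfl fun y hy => by rw [mhKernel_of_ne (ne_of_mem_erase hy)]
  have h2 : ∑ y, mhRate T π x y * (v y - v x) = ∑ y ∈ univ.erase x, mhRate T π x y * (v y - v x) :=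
    (sum_erase _ (by rw [sub_self, mul_zero])).symm
  rw [h1, h2]
  simp_rw [mul_sub, sum_sub_distrib, ← sum_mul]
  ring

section OperatorOrder

variable {π : X → ℝ} {K₁ K₂ : Matrix X X ℝ}

omit [DecidableEq X] in
/-- Scaling of the inner product (private helper). [folklore] -/
private theorem piInner_mul_right (π g u : X → ℝ) (c : ℝ) :
    piInner π g (fun x => c * u x) = c * piInner π g u := by
  unfold piInner
  beta_reduce
  rw [mul_sum]
  exact sum_congr rfl fun x _ => by ring

omit [DecidableEq X] in
/-- Scaling of the Dirichlet form: `𝓔(c u) = c² 𝓔(u)` (private helper). [folklore] -/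
private theorem dirichletForm_mul (π : X → ℝ) (K : Matrix X X ℝ) (u : X → ℝ) (c : ℝ) :
    dirichletForm π K (fun x => c * u x) = c ^ 2 * dirichletForm π K u := by
  unfold dirichletForm
  beta_reduce
  rw [mul_left_comm]
  congr 1
  rw [mul_sum]
  refine sum_congr rfl fun x _ => ?_
  rw [mul_sum]
  exact sum_congr rfl fun y _ => by ring

/-- **The Caracciolo–Pelissetto–Sokal operator lemma, finite form**: for two `π`-reversible
row-stochastic kernels on the same space whose fundamental matrices exist and a constant `c > 0` with
`c 𝓔_{K₂}(φ) ≤ 𝓔_{K₁}(φ)` for every `φ` (i.e. `0 ≤ ⟨φ, c(I − K₂)φ⟩ ≤ ⟨φ, (I − K₁)φ⟩`), the quadratic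
forms of the inverses are ordered the other way on centred vectors:
`⟨g, Z₁ g⟩_π ≤ c⁻¹ ⟨g, Z₂ g⟩_π` — "Let `A` and `B` be self-adjoint operators … satisfying
`0 ≤ ⟨f, Af⟩ ≤ ⟨f, Bf⟩` for all `f`, and the inverses `A⁻¹` and `B⁻¹` exist.  Then
`0 ≤ ⟨f, B⁻¹f⟩ ≤ ⟨f, A⁻¹f⟩`" with `A = c(I − K₂)`, `B = I − K₁` on `L²₀(π)`.  Proof by the variational
formula: `⟨g, Z₁g⟩ = 2⟨g,h₁⟩ − 𝓔₁(h₁) ≤ 2⟨g,h₁⟩ − c𝓔₂(h₁) = c⁻¹[2⟨g, ch₁⟩ − 𝓔₂(ch₁)] ≤ c⁻¹⟨g, Z₂g⟩`.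
[cite: AndrieuVihola2015, Appendix §10 Lemma 53 (after Caracciolo–Pelissetto–Sokal) and §3 (proof
of Corollary 11: "`⟨g̃,(I − P̃)⁻¹g̃⟩_π̃ ≤ w̄⟨g̃,(I − P̄)⁻¹g̃⟩_π̃`")] -/
theorem piInner_fundamentalMatrix_le_of_dirichletForm_le (hπ : ∀ x, 0 < π x) (hπ1 : ∑ x, π x = 1)
    (hK₁ : IsRowStochastic K₁) (hK₂ : IsRowStochastic K₂) (hDB₁ : DetailedBalance π K₁)
    (hDB₂ : DetailedBalance π K₂) (hZ₁ : IsUnit (1 - (K₁ - limitMatrix π)))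
    (hZ₂ : IsUnit (1 - (K₂ - limitMatrix π))) {c : ℝ} (hc : 0 < c)
    (hE : ∀ φ : X → ℝ, c * dirichletForm π K₂ φ ≤ dirichletForm π K₁ φ) {g : X → ℝ}
    (hg : ∑ x, π x * g x = 0) :
    piInner π g (fundamentalMatrix π K₁ *ᵥ g) ≤ c⁻¹ * piInner π g (fundamentalMatrix π K₂ *ᵥ g) := by
  have hst₁ : IsStationary π K₁ := hDB₁.isStationary hK₁.2
  set h₁ := fundamentalMatrix π K₁ *ᵥ g with hh₁
  have e1 := variational_eq hπ1 hK₁ hst₁ hZ₁ hg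
  have e2 := hE h₁
  have e3 := variational_le hπ hπ1 hK₂ hDB₂ hZ₂ hg (fun x => c * h₁ x)
  rw [piInner_mul_right, dirichletForm_mul] at e3
  rw [← hh₁] at e1
  -- `⟨g, Z₁ g⟩ = 2⟨g,h₁⟩ − 𝓔₁(h₁) ≤ 2⟨g,h₁⟩ − c 𝓔₂(h₁)` and `2c⟨g,h₁⟩ − c²𝓔₂(h₁) ≤ ⟨g, Z₂ g⟩`
  have e1' : dirichletForm π K₁ h₁ = piInner π g h₁ := by linarith
  have e4 : c * (c * dirichletForm π K₂ h₁) ≤ c * piInner π g h₁ := by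
    rw [← e1']
    exact mul_le_mul_of_nonneg_left e2 hc.le
  have key : c * piInner π g h₁ ≤ piInner π g (fundamentalMatrix π K₂ *ᵥ g) := by
    linarith [e3, e4]
  have hc' : c ≠ 0 := hc.ne'
  calc piInner π g h₁ = c⁻¹ * (c * piInner π g h₁) := by field_simp
    _ ≤ c⁻¹ * piInner π g (fundamentalMatrix π K₂ *ᵥ g) :=
        mul_le_mul_of_nonneg_left key (inv_nonneg.mpr hc.le)

end OperatorOrder

namespace PseudoMarginal

variable {Ξ : Type*} [Fintype Ξ] [DecidableEq Ξ]

/-! ## The auxiliary kernel `P̄`: marginal move of the state, tilted refresh of the noise -/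

omit [Fintype X] [DecidableEq X] [Fintype Ξ] [DecidableEq Ξ] in
/-- The proposal of `P̄`: move `x ↦ y` by `T` and draw the fresh noise from the TILTED law
`π_y(du) = Q_y(du) u`, i.e. `ξ'` with probability `g ξ' f y ξ' / π y`.
[cite: AndrieuVihola2015, §2 (the display defining `P̄`: "`P̄(x,w; dy, du) := q(x,dy) π_y(du)
min{1, r(x,y)} + δ_{x,w}(dy, du) ρ(x)`") and §1 (`π_x(dw) := Q_x(dw) w`)] -/
noncomputable def barProposal (T : X → X → ℝ) (f : X → Ξ → ℝ) (g : Ξ → ℝ) (π : X → ℝ) :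
    X × Ξ → X × Ξ → ℝ :=
  fun z z' => T z.1 z'.1 * (g z'.2 * f z'.1 z'.2 / π z'.1)

/-- **The auxiliary kernel `P̄`** on `X × Ξ` as a Metropolis–Hastings kernel: proposal
`barProposal` (marginal move, tilted refresh) and weight `π̃ = target f g`; its Hastings ratio is the
MARGINAL one, `r(x,y)` (`barRate_eq`), so this is exactly
`q(x,dy) π_y(du) min{1, r(x,y)} + δ_{x,w}(dy,du) ρ(x)`, "reversible with respect to `π̃`".
[cite: AndrieuVihola2015, §2 (the display defining `P̄`)] -/
noncomputable def barKernel (T : X → X → ℝ) (f : X → Ξ → ℝ) (g : Ξ → ℝ) (π : X → ℝ) :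
    Matrix (X × Ξ) (X × Ξ) ℝ :=
  mhKernel (barProposal T f g π) (target f g)

section Bar

variable {f : X → Ξ → ℝ} {g : Ξ → ℝ} {π : X → ℝ} {T : X → X → ℝ}

omit [Fintype X] [DecidableEq X] [Fintype Ξ] [DecidableEq Ξ] in
/-- **The Hastings rate of `P̄` is the marginal rate times the tilted refresh law**:
`rate_P̄((x,ξ) → (y,ξ')) = (g ξ' f y ξ' / π y) · mhRate T π x y` — the noise law and the estimate at the
CURRENT state cancel, leaving `min{1, r(x,y)}`. [cite: AndrieuVihola2015, §2 (definition of `P̄`: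
acceptance `min{1, r(x,y)}`)] -/
theorem barRate_eq (hf : ∀ x ξ, 0 < f x ξ) (hg : ∀ ξ, 0 < g ξ) (hπ : ∀ x, 0 < π x)
    (T : X → X → ℝ) (x y : X) (ξ ξ' : Ξ) :
    mhRate (barProposal T f g π) (target f g) (x, ξ) (y, ξ') =
      g ξ' * f y ξ' / π y * mhRate T π x y := by
  have hc : 0 ≤ g ξ' * f y ξ' / π y := div_nonneg (mul_nonneg (hg ξ').le (hf y ξ').le) (hπ y).le
  unfold mhRate barProposal target
  simp only
  rw [mul_min_of_nonneg _ _ hc]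
  have hgξ : g ξ ≠ 0 := (hg ξ).ne'
  have hfx : f x ξ ≠ 0 := (hf x ξ).ne'
  have hπx : π x ≠ 0 := (hπ x).ne'
  have hπy : π y ≠ 0 := (hπ y).ne'
  congr 1
  · ring
  · field_simp

omit [Fintype X] [DecidableEq X] [Fintype Ξ] [DecidableEq Ξ] in
/-- The proposal of `P̄` is non-negative. [cite: AndrieuVihola2015, §2 (definition of `P̄`)] -/
theorem barProposal_nonneg (hf : ∀ x ξ, 0 < f x ξ) (hg : ∀ ξ, 0 < g ξ) (hπ : ∀ x, 0 < π x)
    (hT : ∀ x y, 0 ≤ T x y) (z z' : X × Ξ) : 0 ≤ barProposal T f g π z z' :=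
  mul_nonneg (hT _ _) (div_nonneg (mul_nonneg (hg _).le (hf _ _).le) (hπ _).le)

omit [DecidableEq X] [DecidableEq Ξ] in
/-- The proposal of `P̄` has row sums `Σ_y T x y ≤ 1` (the tilted refresh law is a probability:
`Σ_ξ' g ξ' f y ξ' / π y = 1` by unbiasedness). [cite: AndrieuVihola2015, §2 (definition of `P̄`;
`π_y` a probability measure)] -/
theorem sum_barProposal_le (hunb : ∀ x, ∑ ξ, g ξ * f x ξ = π x) (hπ : ∀ x, 0 < π x)
    (hTrow : ∀ x, ∑ y, T x y ≤ 1) (z : X × Ξ) : ∑ z', barProposal T f g π z z' ≤ 1 := by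
  rw [Fintype.sum_prod_type]
  calc ∑ y, ∑ ξ', barProposal T f g π z (y, ξ') = ∑ y, T z.1 y := by
        refine sum_congr rfl fun y _ => ?_
        simp only [barProposal]
        rw [← mul_sum]
        have : ∑ ξ', g ξ' * f y ξ' / π y = 1 := by
          rw [← sum_div, hunb y, div_self (hπ y).ne']
        rw [this, mul_one]
    _ ≤ 1 := hTrow z.1

/-- `P̄` is a stochastic matrix. [cite: AndrieuVihola2015, §2 ("an auxiliary transition probability
`P̄`")] -/
theorem barKernel_isRowStochastic (hf : ∀ x ξ, 0 < f x ξ) (hg : ∀ ξ, 0 < g ξ)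
    (hunb : ∀ x, ∑ ξ, g ξ * f x ξ = π x) (hπ : ∀ x, 0 < π x) (hT : ∀ x y, 0 ≤ T x y)
    (hTrow : ∀ x, ∑ y, T x y ≤ 1) : IsRowStochastic (barKernel T f g π) :=
  mhKernel_isRowStochastic (barProposal_nonneg hf hg hπ hT) (sum_barProposal_le hunb hπ hTrow)
    fun z : X × Ξ => mul_pos (hg z.2) (hf z.1 z.2)

/-- `P̄` "is reversible with respect to `π̃`" (it is a Metropolis–Hastings kernel for `π̃`).
[cite: AndrieuVihola2015, §2 (the sentence introducing `P̄`)] -/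
theorem barKernel_detailedBalance (hf : ∀ x ξ, 0 < f x ξ) (hg : ∀ ξ, 0 < g ξ) (T : X → X → ℝ)
    (π : X → ℝ) : DetailedBalance (target f g) (barKernel T f g π) :=
  mhKernel_detailedBalance (fun z : X × Ξ => mul_pos (hg z.2) (hf z.1 z.2)) _

/-- **`P̄` moves observables of the state exactly as the marginal chain does**:
`(P̄ ũ)(x, ξ) = (P u)(x)` — "`P̄ᵏ f̄(x,w) = Pᵏ f̄(x)` implying `φ_λ(x,w) = φ_λ(x)`".
[cite: AndrieuVihola2015, §3 (proof of Theorem 7)] -/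
theorem barKernel_mulVec_lift (hf : ∀ x ξ, 0 < f x ξ) (hg : ∀ ξ, 0 < g ξ)
    (hunb : ∀ x, ∑ ξ, g ξ * f x ξ = π x) (hπ : ∀ x, 0 < π x) (T : X → X → ℝ) (v : X → ℝ)
    (z : X × Ξ) :
    ((barKernel T f g π : Matrix (X × Ξ) (X × Ξ) ℝ) *ᵥ (lift v : X × Ξ → ℝ)) z =
      ((mhKernel T π : Matrix X X ℝ) *ᵥ v) z.1 := by
  obtain ⟨x, ξ⟩ := z
  rw [barKernel, mhKernel_mulVec_apply, mhKernel_mulVec_apply]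
  simp only [lift_apply]
  congr 1
  simp only [Fintype.sum_prod_type]
  refine sum_congr rfl fun y _ => ?_
  simp_rw [barRate_eq hf hg hπ T x y ξ]
  have e : ∀ ξ', g ξ' * f y ξ' / π y * mhRate T π x y * (v y - v x) =
      g ξ' * (f y ξ' / π y) * (mhRate T π x y * (v y - v x)) := fun ξ' => by ring
  simp_rw [e, ← sum_mul, sum_normWeight hunb hπ y, one_mul]

omit [DecidableEq X] in
/-- Entries of `(I − (K − A)) v` on a finite chain (private helper). [folklore] -/
private theorem fundamentalInv_mulVec' {Y : Type*} [Fintype Y] [DecidableEq Y] (p : Y → ℝ)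
    (K : Matrix Y Y ℝ) (v : Y → ℝ) (z : Y) :
    ((1 - (K - limitMatrix p)) *ᵥ v) z = v z - (K *ᵥ v) z + ∑ y, p y * v y := by
  rw [sub_mulVec, sub_mulVec, one_mulVec, Pi.sub_apply, Pi.sub_apply]
  have : (limitMatrix p *ᵥ v) z = ∑ y, p y * v y := by
    simp [limitMatrix, Matrix.mulVec, dotProduct]
  rw [this]
  ring

/-! ## Irreducibility of `P̄` and of `P` from that of `P̃` -/

omit [Fintype X] [DecidableEq X] [Fintype Ξ] [DecidableEq Ξ] in
/-- Powers of an entrywise non-negative matrix are entrywise non-negative (private helper).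
[folklore] -/
private theorem pow_apply_nonneg' {Y : Type*} [Fintype Y] [DecidableEq Y] {K : Matrix Y Y ℝ}
    (hK : ∀ a b, 0 ≤ K a b) : ∀ (n : ℕ) (a b : Y), 0 ≤ (K ^ n) a b := by
  intro n
  induction n with
  | zero =>
      intro a b
      rw [pow_zero, Matrix.one_apply]
      split_ifs <;> norm_num
  | succ n ih =>
      intro a b
      rw [pow_succ, Matrix.mul_apply]
      exact sum_nonneg fun c _ => mul_nonneg (ih a c) (hK c b)

omit [Fintype X] [DecidableEq X] [Fintype Ξ] [DecidableEq Ξ] in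
/-- IRREDUCIBILITY TRANSFER along a surjection: if every possible move `a → b` of `K` with
`e a ≠ e b` is a possible move `e a → e b` of `K'`, then irreducibility of `K` gives irreducibility of
`K'` (a positive `K`-path maps to a positive `K'`-path once the steps inside the fibres of `e` are
dropped; private helper). [folklore] -/
private theorem isIrreducible_of_surjective {Y Y' : Type*} [Fintype Y] [DecidableEq Y] [Fintype Y']
    [DecidableEq Y'] {K : Matrix Y Y ℝ} {K' : Matrix Y' Y' ℝ} (hK : ∀ a b, 0 ≤ K a b)
    (hK' : ∀ a b, 0 ≤ K' a b) (e : Y → Y') (he : Function.Surjective e)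
    (hstep : ∀ a b, e a ≠ e b → 0 < K a b → 0 < K' (e a) (e b)) (hirr : IsIrreducible K) :
    IsIrreducible K' := by
  have key : ∀ (n : ℕ) (a b : Y), 0 < (K ^ n) a b → ∃ m : ℕ, 0 < (K' ^ m) (e a) (e b) := by
    intro n
    induction n with
    | zero =>
        intro a b h
        rw [pow_zero, Matrix.one_apply] at h
        split_ifs at h with hab
        · subst hab
          exact ⟨0, by rw [pow_zero, Matrix.one_apply_eq]; norm_num⟩
        · exact absurd h (lt_irrefl 0)
    | succ n ih =>
        intro a c h
        rw [pow_succ, Matrix.mul_apply] at h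
        obtain ⟨b, -, hb⟩ : ∃ b ∈ (univ : Finset Y), 0 < (K ^ n) a b * K b c := by
          by_contra hcon
          push Not at hcon
          exact absurd (sum_nonpos hcon) (not_le.mpr h)
        have h1 : 0 < (K ^ n) a b := lt_of_le_of_ne (pow_apply_nonneg' hK n a b) fun h0 => by
          rw [← h0, zero_mul] at hb; exact lt_irrefl 0 hb
        have h2 : 0 < K b c := lt_of_le_of_ne (hK b c) fun h0 => by
          rw [← h0, mul_zero] at hb; exact lt_irrefl 0 hb
        obtain ⟨m, hm⟩ := ih a b h1
        by_cases hbc : e b = e c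
        · exact ⟨m, hbc ▸ hm⟩
        · refine ⟨m + 1, ?_⟩
          have hstep' : 0 < K' (e b) (e c) := hstep b c hbc h2
          calc (0 : ℝ) < (K' ^ m) (e a) (e b) * K' (e b) (e c) := mul_pos hm hstep'
            _ ≤ ∑ d, (K' ^ m) (e a) d * K' d (e c) :=
                single_le_sum (f := fun d => (K' ^ m) (e a) d * K' d (e c))
                  (fun d _ => mul_nonneg (pow_apply_nonneg' hK' m _ _) (hK' _ _)) (mem_univ (e b))
            _ = (K' ^ (m + 1)) (e a) (e c) := by rw [pow_succ, Matrix.mul_apply]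
  intro y y'
  obtain ⟨a, rfl⟩ := he y
  obtain ⟨b, rfl⟩ := he y'
  obtain ⟨n, hn⟩ := hirr a b
  exact key n a b hn

/-- A possible move of `P̃` needs the proposal in both directions: `P̃((x,ξ),(y,ξ')) > 0` with
`(y,ξ') ≠ (x,ξ)` forces `T x y > 0 < T y x` (private helper). [folklore] -/
private theorem proposal_pos_of_kernel_pos (hf : ∀ x ξ, 0 < f x ξ) (hg : ∀ ξ, 0 < g ξ)
    (hT : ∀ x y, 0 ≤ T x y) {x y : X} {ξ ξ' : Ξ} (hne : (y, ξ') ≠ (x, ξ))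
    (hpos : 0 < kernel T f g (x, ξ) (y, ξ')) : 0 < T x y ∧ 0 < T y x := by
  rw [show kernel T f g (x, ξ) (y, ξ') = mhRate (proposal T g) (target f g) (x, ξ) (y, ξ')
    from mhKernel_of_ne hne, rate_eq hf hg T x y ξ ξ'] at hpos
  have hmin : 0 < min (T x y) (f y ξ' * T y x / f x ξ) := by
    rcases (mul_pos_iff.mp hpos) with ⟨_, h⟩ | ⟨h, _⟩
    · exact h
    · exact absurd h (not_lt.mpr (hg ξ').le)
  refine ⟨lt_of_lt_of_le hmin (min_le_left _ _), ?_⟩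
  by_contra hle
  have h0 : T y x = 0 := le_antisymm (not_lt.mp hle) (hT y x)
  have := lt_of_lt_of_le hmin (min_le_right _ _)
  rw [h0, mul_zero, zero_div] at this
  exact lt_irrefl 0 this

/-- Irreducibility of the pseudo-marginal chain passes to the auxiliary chain `P̄` (same possible
moves: `T x y > 0 < T y x`, any fresh noise; private helper). [folklore] -/
private theorem barKernel_isIrreducible (hf : ∀ x ξ, 0 < f x ξ) (hg : ∀ ξ, 0 < g ξ) (hg1 : ∑ ξ, g ξ = 1)
    (hunb : ∀ x, ∑ ξ, g ξ * f x ξ = π x) (hπ : ∀ x, 0 < π x) (hT : ∀ x y, 0 ≤ T x y)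
    (hTrow : ∀ x, ∑ y, T x y ≤ 1)
    (hirr : IsIrreducible (kernel T f g : Matrix (X × Ξ) (X × Ξ) ℝ)) :
    IsIrreducible (barKernel T f g π) := by
  refine isIrreducible_of_surjective (kernel_isRowStochastic hf hg hg1 hT hTrow).1
    (barKernel_isRowStochastic hf hg hunb hπ hT hTrow).1 id Function.surjective_id
    (fun a b hab hpos => ?_) hirr
  obtain ⟨x, ξ⟩ := a
  obtain ⟨y, ξ'⟩ := b
  have hne : (y, ξ') ≠ (x, ξ) := fun h => hab (by rw [h])
  obtain ⟨hxy, hyx⟩ := proposal_pos_of_kernel_pos hf hg hT hne hpos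
  show 0 < barKernel T f g π (x, ξ) (y, ξ')
  rw [show barKernel T f g π (x, ξ) (y, ξ') = mhRate (barProposal T f g π) (target f g) (x, ξ) (y, ξ')
    from mhKernel_of_ne hne, barRate_eq hf hg hπ T x y ξ ξ']
  exact mul_pos (div_pos (mul_pos (hg ξ') (hf y ξ')) (hπ y))
    (lt_min hxy (div_pos (mul_pos (hπ y) hyx) (hπ x)))

/-- Irreducibility of the pseudo-marginal chain passes to the marginal chain `P` (project the
path to the state; the converse of the printed remark "`P̃` is also irreducible … if the marginal
kernel `P` is", Andrieu–Vihola 2015 §8; private helper). [folklore] -/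
private theorem mhKernel_isIrreducible_of_kernel (hf : ∀ x ξ, 0 < f x ξ) (hg : ∀ ξ, 0 < g ξ)
    (hg1 : ∑ ξ, g ξ = 1) (hπ : ∀ x, 0 < π x) (hT : ∀ x y, 0 ≤ T x y) (hTrow : ∀ x, ∑ y, T x y ≤ 1)
    (hirr : IsIrreducible (kernel T f g : Matrix (X × Ξ) (X × Ξ) ℝ)) :
    IsIrreducible (mhKernel T π : Matrix X X ℝ) := by
  rcases isEmpty_or_nonempty Ξ with hΞ | ⟨⟨ξ₀⟩⟩
  · simp at hg1
  refine isIrreducible_of_surjective (kernel_isRowStochastic hf hg hg1 hT hTrow).1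
    (mhKernel_nonneg hT hTrow hπ) Prod.fst (fun x => ⟨(x, ξ₀), rfl⟩) (fun a b hab hpos => ?_) hirr
  obtain ⟨x, ξ⟩ := a
  obtain ⟨y, ξ'⟩ := b
  have hne : (y, ξ') ≠ (x, ξ) := fun h => hab (congrArg Prod.fst h).symm
  obtain ⟨hxy, hyx⟩ := proposal_pos_of_kernel_pos hf hg hT hne hpos
  show 0 < mhKernel T π x y
  rw [mhKernel_of_ne (fun h => hab h.symm)]
  exact lt_min hxy (div_pos (mul_pos (hπ y) hyx) (hπ x))

/-- **The fundamental matrix of `P̄` on observables of the state is that of `P`**: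
`Z̄ (lift w) = lift (Z w)` — so every `π̃`-quadratic form of `Z̄` on lifted functions is the
corresponding `π`-form of `Z` ("Therefore, `var(f, P̄) = var(f, P)`"; here through Kemeny–Snell's
`Z`).  The pseudo-marginal chain is assumed irreducible (then so are `P̄` and `P`, and all three
fundamental matrices are genuine inverses). [cite: AndrieuVihola2015, §3 (proof of Theorem 7: `P̄`
"coincides marginally with the marginal chain")] -/
theorem fundamentalMatrix_barKernel_mulVec_lift (hf : ∀ x ξ, 0 < f x ξ) (hg : ∀ ξ, 0 < g ξ)
    (hg1 : ∑ ξ, g ξ = 1) (hunb : ∀ x, ∑ ξ, g ξ * f x ξ = π x) (hπ : ∀ x, 0 < π x)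
    (hπ1 : ∑ x, π x = 1) (hT : ∀ x y, 0 ≤ T x y) (hTrow : ∀ x, ∑ y, T x y ≤ 1)
    (hirr : IsIrreducible (kernel T f g : Matrix (X × Ξ) (X × Ξ) ℝ)) (w : X → ℝ) :
    fundamentalMatrix (target f g) (barKernel T f g π) *ᵥ (lift w : X × Ξ → ℝ) =
      lift (fundamentalMatrix π (mhKernel T π) *ᵥ w) := by
  have hirrP := mhKernel_isIrreducible_of_kernel hf hg hg1 hπ hT hTrow hirr
  have hirrB := barKernel_isIrreducible hf hg hg1 hunb hπ hT hTrow hirr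
  have hP : IsRowStochastic (mhKernel T π) := mhKernel_isRowStochastic hT hTrow hπ
  have hst : IsStationary π (mhKernel T π) := (mhKernel_detailedBalance hπ T).isStationary hP.2
  have hPbar := barKernel_isRowStochastic hf hg hunb hπ hT hTrow
  have hstbar : IsStationary (target f g) (barKernel T f g π) :=
    (barKernel_detailedBalance hf hg T π).isStationary hPbar.2
  have hπ'1 : ∑ z : X × Ξ, target f g z = 1 := by rw [sum_target_univ hunb, hπ1]
  have hZ := isUnit_fundamentalInv hπ1 hP hst hirrP
  have hZbar := isUnit_fundamentalInv hπ'1 hPbar hstbar hirrB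
  set h := fundamentalMatrix π (mhKernel T π) *ᵥ w with hh
  -- `(I − (P − A)) h = w`, entrywise
  have h2 : ∀ x, h x - ((mhKernel T π : Matrix X X ℝ) *ᵥ h) x + ∑ y, π y * h y = w x := by
    intro x
    have e := congrArg (fun M : Matrix X X ℝ => (M *ᵥ w) x) (fundamentalInv_mul_fundamentalMatrix hZ)
    simp only [← mulVec_mulVec, one_mulVec] at e
    rw [fundamentalInv_mulVec'] at e
    exact e
  -- `(I − (P̄ − Ã)) (lift h) = lift w`
  have h1 : (1 - (barKernel T f g π - limitMatrix (target f g))) *ᵥ (lift h : X × Ξ → ℝ) =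
      lift w := by
    funext z
    rw [fundamentalInv_mulVec', barKernel_mulVec_lift hf hg hunb hπ T h z,
      sum_target_mul_lift hunb h, lift_apply, lift_apply]
    exact h2 z.1
  calc fundamentalMatrix (target f g) (barKernel T f g π) *ᵥ (lift w : X × Ξ → ℝ)
      = fundamentalMatrix (target f g) (barKernel T f g π) *ᵥ
          ((1 - (barKernel T f g π - limitMatrix (target f g))) *ᵥ (lift h : X × Ξ → ℝ)) := by
        rw [h1]
    _ = lift h := by
        rw [mulVec_mulVec, fundamentalMatrix_mul_fundamentalInv hZbar, one_mulVec]

/-- **`var(f, P̄) = var(f, P)`** for observables of the state (finite form, Kemeny–Snell variances;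
irreducible pseudo-marginal chain): `v(ũ, π̃, P̄) = v(u, π, P)`. [cite: AndrieuVihola2015, §3 (proof of
Theorem 7: "Therefore, `var(f, P̄) = var(f, P)`")] -/
theorem asympVar_lift_barKernel (hf : ∀ x ξ, 0 < f x ξ) (hg : ∀ ξ, 0 < g ξ)
    (hg1 : ∑ ξ, g ξ = 1) (hunb : ∀ x, ∑ ξ, g ξ * f x ξ = π x) (hπ : ∀ x, 0 < π x)
    (hπ1 : ∑ x, π x = 1) (hT : ∀ x y, 0 ≤ T x y) (hTrow : ∀ x, ∑ y, T x y ≤ 1)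
    (hirr : IsIrreducible (kernel T f g : Matrix (X × Ξ) (X × Ξ) ℝ)) (u : X → ℝ) :
    asympVar (lift u : X × Ξ → ℝ) (target f g) (barKernel T f g π) = asympVar u π (mhKernel T π) := by
  have hirrP := mhKernel_isIrreducible_of_kernel hf hg hg1 hπ hT hTrow hirr
  have hirrB := barKernel_isIrreducible hf hg hg1 hunb hπ hT hTrow hirr
  have hP : IsRowStochastic (mhKernel T π) := mhKernel_isRowStochastic hT hTrow hπ
  have hst : IsStationary π (mhKernel T π) := (mhKernel_detailedBalance hπ T).isStationary hP.2
  have hPbar := barKernel_isRowStochastic hf hg hunb hπ hT hTrow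
  have hstbar : IsStationary (target f g) (barKernel T f g π) :=
    (barKernel_detailedBalance hf hg T π).isStationary hPbar.2
  have hπ'1 : ∑ z : X × Ξ, target f g z = 1 := by rw [sum_target_univ hunb, hπ1]
  have hZ := isUnit_fundamentalInv hπ1 hP hst hirrP
  have hZbar := isUnit_fundamentalInv hπ'1 hPbar hstbar hirrB
  rw [asympVar_eq_centred hπ'1 hPbar hstbar hZbar, asympVar_eq_centred hπ1 hP hst hZ,
    centred_lift hunb, fundamentalMatrix_barKernel_mulVec_lift hf hg hg1 hunb hπ hπ1 hT hTrow hirr,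
    piInner_lift hunb, piInner_lift hunb]

/-! ## Proposition 10: bounded weights give `𝓔_P̄ ≤ w̄ 𝓔_P̃` -/

omit [Fintype X] [DecidableEq X] [Fintype Ξ] [DecidableEq Ξ] in
/-- A diagonal term of a Dirichlet-form double sum vanishes (private helper). [folklore] -/
private theorem mul_sub_self_sq₃ (a b : ℝ) : a * (b - b) ^ 2 = 0 := by
  rw [sub_self, zero_pow two_ne_zero, mul_zero]

/-- One term of the Dirichlet form of `P̄`: for every pair of extended states,
`π̃(x,ξ) P̄((x,ξ),(y,ξ')) (Δφ)² = (g ξ f x ξ/π x)(g ξ' f y ξ'/π y) min(π x T x y, π y T y x) (Δφ)²` —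
the flow `π(dx) q(x,dy) min{1, r(x,y)}` of the marginal chain times the two tilted noise laws.
[cite: AndrieuVihola2015, §2 Proposition 2 (the functional `Δ_P̄`) and §3 Proposition 10 (proof,
the `𝓔_P̄` display)] -/
theorem target_mul_barKernel_mul_sq (hf : ∀ x ξ, 0 < f x ξ) (hg : ∀ ξ, 0 < g ξ) (hπ : ∀ x, 0 < π x)
    (T : X → X → ℝ) (φ : X × Ξ → ℝ) (x y : X) (ξ ξ' : Ξ) :
    target f g (x, ξ) * barKernel T f g π (x, ξ) (y, ξ') * (φ (x, ξ) - φ (y, ξ')) ^ 2 =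
      (g ξ * f x ξ / π x) * (g ξ' * f y ξ' / π y) * min (π x * T x y) (π y * T y x) *
        (φ (x, ξ) - φ (y, ξ')) ^ 2 := by
  by_cases h : (y, ξ') = (x, ξ)
  · rw [h, mul_sub_self_sq₃, mul_sub_self_sq₃]
  · rw [show barKernel T f g π (x, ξ) (y, ξ') = mhRate (barProposal T f g π) (target f g) (x, ξ) (y, ξ')
      from mhKernel_of_ne h, barRate_eq hf hg hπ T x y ξ ξ']
    congr 1
    have hπx : π x ≠ 0 := (hπ x).ne'
    have e : target f g (x, ξ) * (g ξ' * f y ξ' / π y * mhRate T π x y) =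
        g ξ * f x ξ / π x * (g ξ' * f y ξ' / π y) * (π x * mhRate T π x y) := by
      show g ξ * f x ξ * (g ξ' * f y ξ' / π y * mhRate T π x y) = _
      field_simp
    rw [e, mul_mhRate hπ T x y]

/-- **The Dirichlet form of `P̄` in flow form**, for an arbitrary function of `(x, ξ)`:
`𝓔_P̄(φ) = ½ Σ_x Σ_y Σ_{(ξ,ξ')} (g ξ f x ξ/π x)(g ξ' f y ξ'/π y) min(π x T x y, π y T y x)
(φ(x,ξ) − φ(y,ξ'))²`. [cite: AndrieuVihola2015, §3 (eq. (dirichlet-form) and the proof of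
Proposition 10)] -/
theorem dirichletForm_barKernel_eq (hf : ∀ x ξ, 0 < f x ξ) (hg : ∀ ξ, 0 < g ξ) (hπ : ∀ x, 0 < π x)
    (T : X → X → ℝ) (φ : X × Ξ → ℝ) :
    dirichletForm (target f g) (barKernel T f g π) φ =
      (1 / 2) * ∑ x, ∑ y, ∑ q : Ξ × Ξ,
        (g q.1 * f x q.1 / π x) * (g q.2 * f y q.2 / π y) * min (π x * T x y) (π y * T y x) *
          (φ (x, q.1) - φ (y, q.2)) ^ 2 := by
  unfold dirichletForm
  congr 1
  calc ∑ z : X × Ξ, ∑ z' : X × Ξ,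
        target f g z * (barKernel T f g π : Matrix (X × Ξ) (X × Ξ) ℝ) z z' * (φ z - φ z') ^ 2
      = ∑ x, ∑ ξ, ∑ y, ∑ ξ',
          target f g (x, ξ) * barKernel T f g π (x, ξ) (y, ξ') * (φ (x, ξ) - φ (y, ξ')) ^ 2 := by
        rw [Fintype.sum_prod_type]
        refine sum_congr rfl fun x _ => sum_congr rfl fun ξ _ => ?_
        rw [Fintype.sum_prod_type]
    _ = ∑ x, ∑ y, ∑ ξ, ∑ ξ',
          (g ξ * f x ξ / π x) * (g ξ' * f y ξ' / π y) * min (π x * T x y) (π y * T y x) *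
            (φ (x, ξ) - φ (y, ξ')) ^ 2 := by
        refine sum_congr rfl fun x _ => ?_
        rw [sum_comm]
        exact sum_congr rfl fun y _ => sum_congr rfl fun ξ _ => sum_congr rfl fun ξ' _ =>
          target_mul_barKernel_mul_sq hf hg hπ T φ x y ξ ξ'
    _ = _ := by
        refine sum_congr rfl fun x _ => sum_congr rfl fun y _ => ?_
        simp only [Fintype.sum_prod_type]

omit [Fintype X] [DecidableEq X] [Fintype Ξ] [DecidableEq Ξ] in
/-- The printed minimum step of Proposition 10, termwise: for `0 ≤ w, u ≤ w̄` and `A, B ≥ 0`,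
`w u min(A, B) ≤ w̄ min(w A, u B)` — "`min{1, ab} ≥ min{1, a} min{1, b}`" and
`min{1/u, 1/w} ≥ 1/w̄` (private helper). [cite: AndrieuVihola2015, §3 (proof of Proposition 10)] -/
private theorem mul_mul_min_le {w u A B wbar : ℝ} (hw : 0 ≤ w) (hu : 0 ≤ u) (hA : 0 ≤ A)
    (hB : 0 ≤ B) (hwb : w ≤ wbar) (hub : u ≤ wbar) :
    w * u * min A B ≤ wbar * min (w * A) (u * B) := by
  rcases le_total (w * A) (u * B) with hle | hle
  · rw [min_eq_left hle]
    calc w * u * min A B ≤ w * u * A := mul_le_mul_of_nonneg_left (min_le_left _ _) (mul_nonneg hw hu)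
      _ = u * (w * A) := by ring
      _ ≤ wbar * (w * A) := mul_le_mul_of_nonneg_right hub (mul_nonneg hw hA)
  · rw [min_eq_right hle]
    calc w * u * min A B ≤ w * u * B := mul_le_mul_of_nonneg_left (min_le_right _ _) (mul_nonneg hw hu)
      _ = w * (u * B) := by ring
      _ ≤ wbar * (u * B) := mul_le_mul_of_nonneg_right hwb (mul_nonneg hu hB)

/-- **Andrieu–Vihola 2015, Proposition 10** (finite form): if the normalised weights are bounded,
`f x ξ / π x ≤ w̄` for all `x, ξ` ("`Q_x([0, w̄]) = 1`"), then for EVERY function `φ` of `(x, ξ)`,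
`𝓔_P̄(φ) ≤ w̄ · 𝓔_P̃(φ)`, i.e. "`𝓔_P̃(f) ≥ w̄⁻¹ 𝓔_P̄(f)` for any function with `π̃(f²) < ∞`".  Proof as
printed, termwise on the flows: `min{1, r u/w} ≥ min{1, r} min{1, u/w}` and `min{1/u, 1/w} ≥ 1/w̄`.
[cite: AndrieuVihola2015, §3 Proposition 10] -/
theorem dirichletForm_barKernel_le (hf : ∀ x ξ, 0 < f x ξ) (hg : ∀ ξ, 0 < g ξ) (hπ : ∀ x, 0 < π x)
    (hT : ∀ x y, 0 ≤ T x y) {wbar : ℝ} (hw : ∀ x ξ, f x ξ / π x ≤ wbar) (φ : X × Ξ → ℝ) :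
    dirichletForm (target f g) (barKernel T f g π) φ ≤
      wbar * dirichletForm (target f g) (kernel T f g) φ := by
  rw [dirichletForm_barKernel_eq hf hg hπ, dirichletForm_kernel_eq hf hg]
  conv_rhs => rw [mul_left_comm, mul_sum]
  refine mul_le_mul_of_nonneg_left (sum_le_sum fun x _ => ?_) (by norm_num)
  rw [mul_sum]
  refine sum_le_sum fun y _ => ?_
  rw [mul_sum]
  refine sum_le_sum fun q _ => ?_
  have hπx : π x ≠ 0 := (hπ x).ne'
  have hπy : π y ≠ 0 := (hπ y).ne'
  -- normalised weights `w = f x ξ/π x`, `u = f y ξ'/π y`; flows `A = π x T x y`, `B = π y T y x`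
  have key := mul_mul_min_le (div_nonneg (hf x q.1).le (hπ x).le)
    (div_nonneg (hf y q.2).le (hπ y).le) (mul_nonneg (hπ x).le (hT x y))
    (mul_nonneg (hπ y).le (hT y x)) (hw x q.1) (hw y q.2)
  have e1 : g q.1 * f x q.1 / π x * (g q.2 * f y q.2 / π y) * min (π x * T x y) (π y * T y x) =
      g q.1 * g q.2 * (f x q.1 / π x * (f y q.2 / π y) * min (π x * T x y) (π y * T y x)) := by
    ring
  have e2 : wbar * (g q.1 * g q.2 * min (f x q.1 * T x y) (f y q.2 * T y x) *
      (φ (x, q.1) - φ (y, q.2)) ^ 2) = g q.1 * g q.2 *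
        (wbar * min (f x q.1 / π x * (π x * T x y)) (f y q.2 / π y * (π y * T y x))) *
          (φ (x, q.1) - φ (y, q.2)) ^ 2 := by
    rw [show f x q.1 / π x * (π x * T x y) = f x q.1 * T x y by field_simp,
      show f y q.2 / π y * (π y * T y x) = f y q.2 * T y x by field_simp]
    ring
  rw [e1, e2]
  exact mul_le_mul_of_nonneg_right (mul_le_mul_of_nonneg_left key
    (mul_nonneg (hg _).le (hg _).le)) (sq_nonneg _)

/-! ## Corollary 11: `var(g, P̃) ≤ w̄ var(g, P) + (w̄ − 1) var_π(g)` -/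

/-- **ANDRIEU–VIHOLA 2015, COROLLARY 11** (finite form; the upper bound): "Assume `Gap(P) > 0` and
there exists some `w̄ ∈ [1,∞)` such that (the weights are a.s. bounded by `w̄`) holds.  Let
`g : X → ℝ` satisfying `π(g²) < ∞`, then, the asymptotic variances satisfy
`var(g, P) ≤ var(g, P̃) ≤ w̄ var(g, P) + (w̄ − 1) var_π(g)`, where `var(g, P̃) := var(g̃, P̃)` with
`g̃(x, ·) ≡ g(x)`."  Here: a positive probability vector `π`, `T ≥ 0` with row sums `≤ 1`, a positive
unbiased estimator with normalised weights `f x ξ / π x ≤ w̄`, and an irreducible pseudo-marginal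
chain (the left inequality is `asympVar_le_asympVar_lift`; `var_π(g) = ‖ḡ‖²_π`).  Proof as printed:
Proposition 10, the operator lemma, and `var(g̃, P̄) = var(g, P)`.
[cite: AndrieuVihola2015, §3 Corollary 11 and its proof] -/
theorem asympVar_lift_le_of_weight_le (hf : ∀ x ξ, 0 < f x ξ) (hg : ∀ ξ, 0 < g ξ)
    (hg1 : ∑ ξ, g ξ = 1) (hunb : ∀ x, ∑ ξ, g ξ * f x ξ = π x) (hπ : ∀ x, 0 < π x)
    (hπ1 : ∑ x, π x = 1) (hT : ∀ x y, 0 ≤ T x y) (hTrow : ∀ x, ∑ y, T x y ≤ 1) {wbar : ℝ}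
    (hw : ∀ x ξ, f x ξ / π x ≤ wbar)
    (hirr : IsIrreducible (kernel T f g : Matrix (X × Ξ) (X × Ξ) ℝ)) (u : X → ℝ) :
    asympVar (lift u : X × Ξ → ℝ) (target f g) (kernel T f g) ≤
      wbar * asympVar u π (mhKernel T π) + (wbar - 1) * piInner π (centred π u) (centred π u) := by
  -- `w̄ > 0` (the weights are positive)
  rcases isEmpty_or_nonempty Ξ with hΞ | ⟨⟨ξ₀⟩⟩
  · simp at hg1
  rcases isEmpty_or_nonempty X with hX | ⟨⟨x₀⟩⟩
  · simp at hπ1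
  have hwpos : 0 < wbar := lt_of_lt_of_le (div_pos (hf x₀ ξ₀) (hπ x₀)) (hw x₀ ξ₀)
  -- the three chains
  have hP : IsRowStochastic (mhKernel T π) := mhKernel_isRowStochastic hT hTrow hπ
  have hDB : DetailedBalance π (mhKernel T π) := mhKernel_detailedBalance hπ T
  have hst : IsStationary π (mhKernel T π) := hDB.isStationary hP.2
  have hKrow : IsRowStochastic (kernel T f g) := kernel_isRowStochastic hf hg hg1 hT hTrow
  have hDBK : DetailedBalance (target f g) (kernel T f g) := kernel_detailedBalance hf hg T
  have hstK : IsStationary (target f g) (kernel T f g) := hDBK.isStationary hKrow.2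
  have hBrow : IsRowStochastic (barKernel T f g π) := barKernel_isRowStochastic hf hg hunb hπ hT hTrow
  have hDBB : DetailedBalance (target f g) (barKernel T f g π) := barKernel_detailedBalance hf hg T π
  have hstB : IsStationary (target f g) (barKernel T f g π) := hDBB.isStationary hBrow.2
  have hπ'pos : ∀ z : X × Ξ, 0 < target f g z := fun z => mul_pos (hg z.2) (hf z.1 z.2)
  have hπ'1 : ∑ z : X × Ξ, target f g z = 1 := by rw [sum_target_univ hunb, hπ1]
  have hirrB := barKernel_isIrreducible hf hg hg1 hunb hπ hT hTrow hirr
  have hirrP := mhKernel_isIrreducible_of_kernel hf hg hg1 hπ hT hTrow hirr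
  have hZK := isUnit_fundamentalInv hπ'1 hKrow hstK hirr
  have hZB := isUnit_fundamentalInv hπ'1 hBrow hstB hirrB
  have hZP := isUnit_fundamentalInv hπ1 hP hst hirrP
  -- the centred observable and its lift
  have huc : ∑ x, π x * centred π u x = 0 := sum_mul_centred hπ1 u
  have hlift : centred (target f g) (lift u : X × Ξ → ℝ) = lift (centred π u) := centred_lift hunb u
  have huc' : ∑ z : X × Ξ, target f g z * (lift (centred π u) : X × Ξ → ℝ) z = 0 := by
    rw [sum_target_mul_lift hunb, huc]
  -- (1) the two variances in centred form
  have e1 := asympVar_eq_centred hπ'1 hKrow hstK hZK (lift u : X × Ξ → ℝ)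
  rw [hlift] at e1
  have e2 := asympVar_eq_centred hπ1 hP hst hZP u
  -- (2) Proposition 10 + the operator lemma: `⟨ḡ̃, Z̃ ḡ̃⟩ ≤ w̄ ⟨ḡ̃, Z̄ ḡ̃⟩`
  have hE : ∀ φ : X × Ξ → ℝ, wbar⁻¹ * dirichletForm (target f g) (barKernel T f g π) φ ≤
      dirichletForm (target f g) (kernel T f g) φ := by
    intro φ
    rw [inv_mul_le_iff₀ hwpos]
    exact dirichletForm_barKernel_le hf hg hπ hT hw φ
  have hop := piInner_fundamentalMatrix_le_of_dirichletForm_le hπ'pos hπ'1 hKrow hBrow hDBK hDBB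
    hZK hZB (inv_pos.mpr hwpos) hE huc'
  rw [inv_inv] at hop
  -- (3) `⟨ḡ̃, Z̄ ḡ̃⟩_π̃ = ⟨ḡ, Z ḡ⟩_π` and `‖ḡ̃‖²_π̃ = ‖ḡ‖²_π`
  have e3 : piInner (target f g) (lift (centred π u) : X × Ξ → ℝ)
      (fundamentalMatrix (target f g) (barKernel T f g π) *ᵥ (lift (centred π u) : X × Ξ → ℝ)) =
      piInner π (centred π u) (fundamentalMatrix π (mhKernel T π) *ᵥ centred π u) := by
    rw [fundamentalMatrix_barKernel_mulVec_lift hf hg hg1 hunb hπ hπ1 hT hTrow hirr, piInner_lift hunb]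
  have e4 : piInner (target f g) (lift (centred π u) : X × Ξ → ℝ) (lift (centred π u)) =
      piInner π (centred π u) (centred π u) := piInner_lift hunb _ _
  rw [e3] at hop
  -- (4) assemble
  rw [e1, e2, e4]
  have : wbar * (2 * piInner π (centred π u) (fundamentalMatrix π (mhKernel T π) *ᵥ centred π u)
      - piInner π (centred π u) (centred π u)) + (wbar - 1) * piInner π (centred π u) (centred π u) =
      2 * (wbar * piInner π (centred π u) (fundamentalMatrix π (mhKernel T π) *ᵥ centred π u))
        - piInner π (centred π u) (centred π u) := by ring
  rw [this]
  linarith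

end Bar

end PseudoMarginal

end Literature.Probability.MarkovChains
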